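import Summits.Ventures.HodgeRepro2.T5CharacterDeterminesGeneral

/-!
# The dimension of the space of intertwiners is the multiplicity

For a continuous finite-dimensional representation `π` of a compact Hausdorff group `G` and a
continuous irreducible `σ`, the space of intertwining maps `Hom_G(σ, π)` (Mathlib's
`Representation.IntertwiningMap (toRep σ) (toRep π)`) has dimension
`∫ χ_π · conj χ_σ = #{summands of an irreducible decomposition of π equivalent to σ}`.

Tools: `Hom_G(σ, ·)` turns a representation equivalence into a linear equivalence
(`homEquivOfEquiv`) and a product into a product (`homProdEquiv`); a stable complement
`V = W ⊕ C` realises `toRep π` as the product of the two restrictions (`equivProdOfIsCompl`); Schur's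
lemma (Mathlib `Representation.IsIrreducible.finrank_intertwiningMap_self` and
`instSubsingletonIntertwiningMapOfIsEmptyEquiv`) gives `dim Hom_G(σ, τ) ∈ {1, 0}` for irreducible
`σ`, `τ` according to whether `σ ≃ τ`; strong induction on `dim V` as in
`T5CharacterDeterminesGeneral`.

Blind lane: Mathlib + own prefix only; no sorry; axioms ⊆ {propext, Classical.choice, Quot.sound}.
-/

namespace Summit.Ventures.HodgeRepro2.T5IntertwinerDimension

open T5SchurOrthogonality T5CompleteReducibility T5RestrictionRep T5Multiplicity T5SchurMathlib
  T5CharacterDeterminesGeneral MeasureTheory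

universe u u'

section General

variable {A : Type*} [CommSemiring A] {G : Type*} [Monoid G]
  {V : Type*} [AddCommMonoid V] [Module A V] {W : Type*} [AddCommMonoid W] [Module A W]
  {U : Type*} [AddCommMonoid U] [Module A U]

/-- `(f.prod g) v = (f v, g v)`. -/
theorem intertwiningMap_prod_apply {σ : Representation A G V} {ρ₁ : Representation A G W}
    {ρ₂ : Representation A G U} (f : σ.IntertwiningMap ρ₁) (g : σ.IntertwiningMap ρ₂) (v : V) :
    (f.prod g) v = (f v, g v) := rfl

/-- Composition with a representation equivalence `e : ρ ≃ ρ'` is a linear equivalence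
`Hom_G(σ, ρ) ≃ₗ Hom_G(σ, ρ')`. -/
noncomputable def homEquivOfEquiv (σ : Representation A G V) {ρ : Representation A G W}
    {ρ' : Representation A G U} (e : ρ.Equiv ρ') :
    σ.IntertwiningMap ρ ≃ₗ[A] σ.IntertwiningMap ρ' where
  toFun f := e.toIntertwiningMap.comp f
  invFun f := e.symm.toIntertwiningMap.comp f
  map_add' f g := Representation.IntertwiningMap.add_comp _ _ _ _ f g
  map_smul' a f := Representation.IntertwiningMap.comp_smul _ _ _ a _ f
  left_inv f := by
    apply Representation.IntertwiningMap.ext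
    apply LinearMap.ext
    intro v
    simp only [Representation.IntertwiningMap.coe_toLinearMap,
      Representation.IntertwiningMap.comp_apply, Representation.Equiv.coe_toIntertwiningMap,
      Representation.Equiv.symm_apply_apply]
  right_inv f := by
    apply Representation.IntertwiningMap.ext
    apply LinearMap.ext
    intro v
    simp only [Representation.IntertwiningMap.coe_toLinearMap,
      Representation.IntertwiningMap.comp_apply, Representation.Equiv.coe_toIntertwiningMap,
      Representation.Equiv.apply_symm_apply]

/-- `Hom_G(σ, ρ₁ × ρ₂) ≃ₗ Hom_G(σ, ρ₁) × Hom_G(σ, ρ₂)`. -/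
noncomputable def homProdEquiv (σ : Representation A G V) (ρ₁ : Representation A G W)
    (ρ₂ : Representation A G U) :
    σ.IntertwiningMap (ρ₁.prod ρ₂) ≃ₗ[A] σ.IntertwiningMap ρ₁ × σ.IntertwiningMap ρ₂ where
  toFun f := ((Representation.IntertwiningMap.fst A ρ₁ ρ₂).comp f,
    (Representation.IntertwiningMap.snd A ρ₁ ρ₂).comp f)
  invFun p := p.1.prod p.2
  map_add' f g := Prod.ext (Representation.IntertwiningMap.add_comp _ _ _ _ f g)
    (Representation.IntertwiningMap.add_comp _ _ _ _ f g)
  map_smul' a f := Prod.ext (Representation.IntertwiningMap.comp_smul _ _ _ a _ f)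
    (Representation.IntertwiningMap.comp_smul _ _ _ a _ f)
  left_inv f := by
    apply Representation.IntertwiningMap.ext
    apply LinearMap.ext
    intro v
    simp only [Representation.IntertwiningMap.coe_toLinearMap, intertwiningMap_prod_apply,
      Representation.IntertwiningMap.comp_apply, Representation.IntertwiningMap.fst_apply,
      Representation.IntertwiningMap.snd_apply]
  right_inv p := Prod.ext (Representation.IntertwiningMap.fst_prod p.1 p.2)
    (Representation.IntertwiningMap.snd_prod p.1 p.2)

end General

variable {G : Type*} [Group G]

section Compl

variable {V : Type u} [NormedAddCommGroup V] [InnerProductSpace ℂ V]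

/-- A stable complement `V = W ⊕ C` realises `toRep π` as the product of the two restricted
representations: `toRep (π|W) × toRep (π|C) ≃ toRep π`. -/
noncomputable def equivProdOfIsCompl (π : G →* V →L[ℂ] V) {W C : Submodule ℂ V} (hW : IsStable π W)
    (hC : IsStable π C) (hWC : IsCompl W C) :
    ((toRep (restrictRep π W hW)).prod (toRep (restrictRep π C hC))).Equiv (toRep π) :=
  Representation.Equiv.mk (W.prodEquivOfIsCompl C hWC) fun g => by
    apply LinearMap.ext
    rintro ⟨x, y⟩
    simp only [LinearMap.comp_apply, LinearEquiv.coe_coe, Submodule.coe_prodEquivOfIsCompl']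
    show ↑(restrictRep π W hW g x) + ↑(restrictRep π C hC g y) = π g (↑x + ↑y)
    rw [map_add, coe_restrictRep_apply, coe_restrictRep_apply]

end Compl

section Schur

variable {W₀ : Type*} [NormedAddCommGroup W₀] [InnerProductSpace ℂ W₀] [FiniteDimensional ℂ W₀]
  {W : Type*} [NormedAddCommGroup W] [InnerProductSpace ℂ W]

open scoped Classical in
/-- **Schur**: for irreducible `σ`, `τ` the intertwiner space has dimension `1` if `σ ≃ τ` and `0`
otherwise. -/
theorem finrank_intertwiningMap_irreducible (σ : G →* W₀ →L[ℂ] W₀) (τ : G →* W →L[ℂ] W)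
    [Nontrivial W₀] [Nontrivial W] (hσ : IsIrreducible σ) (hτ : IsIrreducible τ) :
    Module.finrank ℂ ((toRep σ).IntertwiningMap (toRep τ)) =
      if Nonempty ((toRep σ).Equiv (toRep τ)) then 1 else 0 := by
  classical
  haveI : (toRep σ).IsIrreducible := (isIrreducible_iff σ).1 hσ
  haveI : (toRep τ).IsIrreducible := (isIrreducible_iff τ).1 hτ
  split_ifs with h
  · obtain ⟨e⟩ := h
    rw [← LinearEquiv.finrank_eq (homEquivOfEquiv (toRep σ) e)]
    exact Representation.IsIrreducible.finrank_intertwiningMap_self (toRep σ)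
  · haveI : IsEmpty ((toRep σ).Equiv (toRep τ)) := not_nonempty_iff.1 h
    exact Module.finrank_zero_of_subsingleton

end Schur

section Main

variable [TopologicalSpace G] [IsTopologicalGroup G] [MeasurableSpace G] [BorelSpace G]
  [CompactSpace G] [T2Space G]
variable {W₀ : Type*} [NormedAddCommGroup W₀] [InnerProductSpace ℂ W₀] [FiniteDimensional ℂ W₀]

/-- The induction: `dim Hom_G(σ, π) = ∫ χ_π · conj χ_σ` for every `π` of dimension `n`. -/
theorem finrank_intertwiningMap_eq_integral_aux [Nontrivial W₀] (σ : G →* W₀ →L[ℂ] W₀)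
    (hσc : Continuous σ) (hσi : IsIrreducible σ) (n : ℕ) :
    ∀ {V : Type u} [NormedAddCommGroup V] [InnerProductSpace ℂ V] [FiniteDimensional ℂ V]
      (π : G →* V →L[ℂ] V), Continuous π → Module.finrank ℂ V = n →
      (Module.finrank ℂ ((toRep σ).IntertwiningMap (toRep π)) : ℂ) =
        ∫ g, character π g * (starRingEnd ℂ) (character σ g) ∂haarProb G := by
  induction n using Nat.strong_induction_on with
  | _ n ih =>
  intro V _ _ _ π hπ hn
  by_cases hn0 : n = 0
  · subst hn0
    haveI : Subsingleton V := Module.finrank_zero_iff.1 hn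
    haveI : Subsingleton ((toRep σ).IntertwiningMap (toRep π)) :=
      ⟨fun f g => Representation.IntertwiningMap.ext (LinearMap.ext fun v => Subsingleton.elim _ _)⟩
    have hchar : ∀ g, character π g = 0 := by
      intro g
      change LinearMap.trace ℂ V (π g : V →ₗ[ℂ] V) = 0
      rw [Subsingleton.elim (π g : V →ₗ[ℂ] V) 0, map_zero]
    simp only [Module.finrank_zero_of_subsingleton, Nat.cast_zero, hchar, zero_mul,
      integral_zero]
  · have htop : (⊤ : Submodule ℂ V) ≠ ⊥ := by
      intro hbot
      apply hn0
      rw [← hn, ← finrank_top ℂ V, Submodule.finrank_eq_zero]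
      exact hbot
    obtain ⟨W, -, hW⟩ := exists_irreducibleSubspace_le π (isStable_top π) htop
    obtain ⟨C, hC, hWC⟩ := T5AveragedProjection.exists_isCompl_isStable_of_compact π hπ hW.2.1
    haveI : Nontrivial W := nontrivial_of_isIrreducibleSubspace π W hW
    -- dimension count through the product decomposition
    have hsplit : Module.finrank ℂ ((toRep σ).IntertwiningMap (toRep π)) =
        Module.finrank ℂ ((toRep σ).IntertwiningMap (toRep (restrictRep π W hW.2.1))) +
          Module.finrank ℂ ((toRep σ).IntertwiningMap (toRep (restrictRep π C hC))) := by
      rw [← LinearEquiv.finrank_eq (homEquivOfEquiv (toRep σ) (equivProdOfIsCompl π hW.2.1 hC hWC)),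
        LinearEquiv.finrank_eq (homProdEquiv (toRep σ) _ _), Module.finrank_prod]
    have hlt : Module.finrank ℂ C < n := by
      have hWpos : 0 < Module.finrank ℂ W :=
        Nat.pos_of_ne_zero fun h0 => hW.1 (Submodule.finrank_eq_zero.1 h0)
      have := Submodule.finrank_add_eq_of_isCompl hWC
      omega
    have hIH := ih _ hlt (restrictRep π C hC) (continuous_restrictRep π hπ C hC) rfl
    have hW1 := finrank_intertwiningMap_irreducible σ (restrictRep π W hW.2.1) hσi
      (isIrreducible_restrictRep π W hW _)
    have hint := T5CharacterTheory.integral_character_mul_conj_eq_ite (haarProb G)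
      (restrictRep π W hW.2.1) σ (continuous_restrictRep π hπ W _) hσc
      (isIrreducible_restrictRep π W hW _) hσi
    have hadd : (fun g => character π g * (starRingEnd ℂ) (character σ g)) =
        fun g => character (restrictRep π W hW.2.1) g * (starRingEnd ℂ) (character σ g) +
          character (restrictRep π C hC) g * (starRingEnd ℂ) (character σ g) := by
      funext g
      rw [character_eq_add_of_isCompl π hW.2.1 hC hWC g, add_mul]
    rw [hsplit, Nat.cast_add, hIH, hadd, integral_add, hint, hW1]
    · split_ifs <;> simp
    · exact T5CharacterTheory.integrable_character_mul_conj (haarProb G) _ σ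
        (continuous_restrictRep π hπ W _) hσc
    · exact T5CharacterTheory.integrable_character_mul_conj (haarProb G) _ σ
        (continuous_restrictRep π hπ C hC) hσc

variable {V : Type u} [NormedAddCommGroup V] [InnerProductSpace ℂ V] [FiniteDimensional ℂ V]

/-- **`dim Hom_G(σ, π) = ∫ χ_π · conj χ_σ`** for a continuous finite-dimensional `π` and a
continuous irreducible `σ` of a compact Hausdorff group. -/
theorem finrank_intertwiningMap_eq_integral [Nontrivial W₀] (σ : G →* W₀ →L[ℂ] W₀)
    (hσc : Continuous σ) (hσi : IsIrreducible σ) (π : G →* V →L[ℂ] V) (hπ : Continuous π) :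
    (Module.finrank ℂ ((toRep σ).IntertwiningMap (toRep π)) : ℂ) =
      ∫ g, character π g * (starRingEnd ℂ) (character σ g) ∂haarProb G :=
  finrank_intertwiningMap_eq_integral_aux σ hσc hσi _ π hπ rfl

open scoped Classical in
/-- **`dim Hom_G(σ, π)` is the multiplicity of `σ` in `π`**: the number of summands of any
irreducible internal decomposition of `V` that are equivalent to `σ`. -/
theorem finrank_intertwiningMap_eq_sum [Nontrivial W₀] (σ : G →* W₀ →L[ℂ] W₀)
    (hσc : Continuous σ) (hσi : IsIrreducible σ) (π : G →* V →L[ℂ] V) (hπ : Continuous π)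
    (S : Finset (Submodule ℂ V)) (hS : ∀ W ∈ S, IsIrreducibleSubspace π W)
    (hint : DirectSum.IsInternal fun W : S => (W : Submodule ℂ V)) :
    Module.finrank ℂ ((toRep σ).IntertwiningMap (toRep π)) =
      ∑ W : S, if Nonempty ((toRep σ).Equiv (toRep (restrictRep π W (hS W W.2).2.1))) then 1
        else 0 := by
  have h := finrank_intertwiningMap_eq_integral σ hσc hσi π hπ
  rw [integral_character_mul_conj_eq_sum π hπ σ hσc hσi S hS hint] at h
  exact_mod_cast h

/-- The intertwiner space from an irreducible `σ` into `π` is non-zero iff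
`∫ χ_π · conj χ_σ ≠ 0` (iff `π` contains a copy of `σ`). -/
theorem intertwiningMap_nontrivial_iff [Nontrivial W₀] (σ : G →* W₀ →L[ℂ] W₀)
    (hσc : Continuous σ) (hσi : IsIrreducible σ) (π : G →* V →L[ℂ] V) (hπ : Continuous π) :
    Nontrivial ((toRep σ).IntertwiningMap (toRep π)) ↔
      ∫ g, character π g * (starRingEnd ℂ) (character σ g) ∂haarProb G ≠ 0 := by
  rw [← finrank_intertwiningMap_eq_integral σ hσc hσi π hπ, Nat.cast_ne_zero,
    ← Nat.pos_iff_ne_zero]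
  exact Module.finrank_pos_iff.symm

end Main

end Summit.Ventures.HodgeRepro2.T5IntertwinerDimension
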